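import Summits.ValiantsHypothesis.ValiantsHypothesis.Theorems.BarrierLeverPartitionMinorsBlockVandermondePrelims

/-!
# Route BarrierLever — item `PartitionMinorsHitByVP` (stmt-ValiantsHypothesis-19717):
# the BLOCK generalized-Vandermonde theorem (algebra of block-contiguous certificates)

Helper file (`--supports stmt-ValiantsHypothesis-19717`; cell valiant-natproofs, rung V4, 𝒟-side door (c),
prover seat val-np-p1, gen 11). Closes NO item; definition-free; pure algebra over `K[X]`, `K` a field of
ANY characteristic.

**Theorem (`det_pow_ne_zero_of_blocks`).** Let `ξ_i = X^{m_i} (1 + X ρ_i) ∈ K[X]` (`m_i ≥ 1`; the `ρ_i`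
distinct inside each valuation class `{i : m_i = μ}`) and let `D : ι → ℕ` be injective exponents indexed by the
same type (column `j` carries `z^{D_j}`). If `m_i < m_{i'} ⇒ D_{i'} < D_i` (higher valuation class ↦ smaller
exponents) and `m_i = m_{i'} ⇒ D_i < D_{i'} + #class` (inside a class of size `g` the `g` distinct exponents lie
in a window of width `< g`, i.e. they are CONSECUTIVE), then `det [ξ_i^{D_j}]_{i,j} ≠ 0`.
This is the leading-term count «number of minimising semistandard tableaux = 1 for block-constant shapes» of
val-np-p1 g10's memo (FROBENIUS-MEMO §7), proved WITHOUT Schur polynomials by an induction that carries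
perturbed columns `F_j(z) = c_{j,D_j} z^{D_j} + (terms of degree ≥ T)`, `c_{j,D_j}(0) ≠ 0`
(`det_blockVandermonde_ne_zero`, `det_ne_zero_aux`):
rescale `z = X^μ z'` by the least valuation `μ` (the perturbations become divisible by `X`); Taylor-divide the
least class `ξ'_i = 1 + X ρ_i` by its node polynomial `∏ (Y − X ρ_i)` (`…Prelims.eval_node_eq_sum`): the class
rows factor as `Vandermonde(ρ) · diag(X^k) · Ñ` with `Ñ ≡ [c_{j,D_j}(0) · C(D_j, k)]` modulo `X`
(`…Prelims.map_coeff_modByMonic_nodes`), whose block on the class columns is the unimodular Pascal block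
(`…Prelims.pascal_det_eq_one`, the class exponents being a run by `…Prelims.exists_runEquiv`); eliminate with the
adjugate (`…Prelims.det_fromBlocks_ne_zero_of_schur`): the Schur complement is `[H_j(ξ'_i)]` over the remaining
classes with `H_j = d c_j z^{D_j} + (degree ≥ min D(class))`, `d(0) ≠ 0` — the same shape, one class fewer.

Also `det_pow_ne_zero_of_zero_row`: a row with `ξ = 0` facing the unique exponent `0` is peeled off (the empty
row of a layout). Used by `…PartitionMinorsHitByVPBlockContiguous` (Frobenius table ⇒ `[ξ_{u i}^{D_j}]` in `𝔽_p[t]`).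
WHAT THIS IS NOT: nothing on circuits here; item 19717 stays open; nothing on CPM, crux 14610 or VP vs VNP.
-/

set_option linter.dupNamespace false

namespace Summit.ValiantsHypothesis.ValiantsHypothesis.Theorems.BarrierLever.BlockVandermonde

open Finset Polynomial Matrix

noncomputable section

/-! ## 5. The block generalized-Vandermonde theorem -/

universe u

/-- **BLOCK GENERALIZED VANDERMONDE (inductive form).** Rows `ξ_i = X^{m_i} (1 + X ρ_i)` (`m_i ≥ 1`,
distinct within a valuation class), columns `F_j(z) = Σ_e c_{j e} z^e` with a constant-term-unit coefficient at
`z^{D_j}` and no other term below degree `T > D_j`; the exponents `D_j` are distinct, DEcreasing across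
INcreasing valuation classes, and within a class of size `g` pairwise closer than `g` (so each class carries a run
of `g` consecutive exponents). Then `det [F_j(ξ_i)] ≠ 0` in `K[X]`. Proof: induction on the number of rows —
rescale by `X^μ` (`μ` the least valuation), Taylor-divide the least class by its node polynomial (Vandermonde in
the `ρ_i` times a matrix congruent modulo `X` to the unimodular Pascal block), eliminate with the adjugate; the
Schur complement has the same shape with one class fewer. -/
theorem det_ne_zero_aux (K : Type*) [Field K] (n : ℕ) :
    ∀ {ι : Type u} [Fintype ι] [DecidableEq ι], Fintype.card ι = n →
    ∀ (m : ι → ℕ) (ρ : ι → K[X]) (D : ι → ℕ) (T N : ℕ) (c : ι → Fin N → K[X])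
      (hDN : ∀ j, D j < N),
      (∀ i, 1 ≤ m i) →
      (∀ i i', m i = m i' → ρ i = ρ i' → i = i') →
      Function.Injective D →
      (∀ j, D j < T) →
      (∀ j, (c j ⟨D j, hDN j⟩).coeff 0 ≠ 0) →
      (∀ j (e : Fin N), (e : ℕ) < T → (e : ℕ) ≠ D j → c j e = 0) →
      (∀ i i', m i < m i' → D i' < D i) →
      (∀ i i', m i = m i' → D i < D i' + Fintype.card {k // m k = m i}) →
      (Matrix.of fun i j : ι => ∑ e : Fin N, (X ^ (m i) * (1 + X * ρ i)) ^ (e : ℕ) * c j e).det ≠ 0 := by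
  induction n using Nat.strong_induction_on with
  | _ n ih =>
  intro ι _ _ hn m ρ D T N c hDN hm hρ hD hDT hc0 hcT hlt heq
  rcases isEmpty_or_nonempty ι with hι | hι
  · rw [Matrix.det_isEmpty]
    exact one_ne_zero
  /- the least valuation `μ` -/
  obtain ⟨i₀, -, hi₀⟩ := Finset.exists_min_image Finset.univ m Finset.univ_nonempty
  have hμ : ∀ i, m i₀ ≤ m i := fun i => hi₀ i (Finset.mem_univ i)
  have hμ1 : 1 ≤ m i₀ := hm i₀
  /- STEP 1: rescaling `ξ_i = X^μ ξ'_i`, `F_j(X^μ z) = X^{μ D_j} F'_j(z)` -/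
  set ξ' : ι → K[X] := fun i => X ^ (m i - m i₀) * (1 + X * ρ i) with hξ'
  set c' : ι → Fin N → K[X] := fun j e => X ^ (m i₀ * ((e : ℕ) - D j)) * c j e with hc'
  set M' : Matrix ι ι K[X] := Matrix.of fun i j => ∑ e : Fin N, ξ' i ^ (e : ℕ) * c' j e with hM'
  have hresc : (Matrix.of fun i j : ι => ∑ e : Fin N, (X ^ (m i) * (1 + X * ρ i)) ^ (e : ℕ) * c j e)
      = M' * Matrix.diagonal (fun j => X ^ (m i₀ * D j)) := by
    refine Matrix.ext fun i j => ?_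
    simp only [Matrix.mul_diagonal, hM', Matrix.of_apply, Finset.sum_mul]
    refine Finset.sum_congr rfl fun e _ => ?_
    by_cases he : D j ≤ (e : ℕ)
    · have h1 : X ^ (m i) * (1 + X * ρ i) = X ^ (m i₀) * ξ' i := by
        rw [hξ', ← mul_assoc, ← pow_add, Nat.add_sub_cancel' (hμ i)]
      have h2 : m i₀ * (e : ℕ) = m i₀ * ((e : ℕ) - D j) + m i₀ * D j := by
        rw [← Nat.mul_add, Nat.sub_add_cancel he]
      rw [h1, mul_pow, ← pow_mul, h2, pow_add, hc']
      ring
    · have hce : c j e = 0 := hcT j e (by have := hDT j; omega) (by omega)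
      rw [hc']
      simp only [hce, mul_zero, zero_mul]
  rw [hresc, Matrix.det_mul, Matrix.det_diagonal]
  refine mul_ne_zero ?_ (Finset.prod_ne_zero_iff.mpr fun j _ => pow_ne_zero _ X_ne_zero)
  /- facts about `c'` -/
  have hc'D : ∀ j, c' j ⟨D j, hDN j⟩ = c j ⟨D j, hDN j⟩ := fun j => by
    rw [hc']
    simp only [Nat.sub_self, mul_zero, pow_zero, one_mul]
  have hc'T : ∀ j (e : Fin N), (e : ℕ) < T → (e : ℕ) ≠ D j → c' j e = 0 := fun j e h1 h2 => by
    rw [hc']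
    simp only [hcT j e h1 h2, mul_zero]
  have hc'0 : ∀ j (e : Fin N), (e : ℕ) ≠ D j → (c' j e).coeff 0 = 0 := fun j e h2 => by
    by_cases h1 : (e : ℕ) < T
    · rw [hc'T j e h1 h2, coeff_zero]
    · have hpos : m i₀ * ((e : ℕ) - D j) ≠ 0 := by
        have := hDT j
        exact Nat.mul_ne_zero (by omega) (by omega)
      rw [hc']
      simp only [coeff_X_pow_mul', if_neg (Nat.not_le.mpr (Nat.pos_of_ne_zero hpos))]
  /- STEP 2: the least class `ι₁` and the rest `ι₂` -/
  set ι₁ := {i // m i = m i₀} with hι₁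
  set ι₂ := {i // ¬ m i = m i₀} with hι₂
  haveI : Nonempty ι₁ := ⟨⟨i₀, rfl⟩⟩
  have hcard : Fintype.card ι₁ + Fintype.card ι₂ = n := by
    show Fintype.card {i // m i = m i₀} + Fintype.card {i // ¬ m i = m i₀} = n
    rw [Fintype.card_subtype_compl, Nat.add_sub_cancel' (Fintype.card_subtype_le _), hn]
  have hcard₁ : 0 < Fintype.card ι₁ := Fintype.card_pos
  have hμ2 : ∀ i : ι₂, m i₀ < m i.1 := fun i => lt_of_le_of_ne (hμ i.1) (Ne.symm i.2)
  /- the run structure of the exponents of the least class -/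
  obtain ⟨A, κ, ⟨k₀, hk₀⟩, hκ⟩ := exists_runEquiv (fun i : ι₁ => D i.1)
      (fun i i' h => Subtype.ext (hD h)) (fun i i' => by
        have h1 := heq i.1 i'.1 (by rw [i.2, i'.2])
        have h2 : Fintype.card {k // m k = m i.1} = Fintype.card ι₁ := by rw [i.2]
        omega)
  have hAT : A < T := by rw [← hk₀]; exact hDT k₀.1
  have hA2 : ∀ j : ι₂, D j.1 < A := fun j => by rw [← hk₀]; exact hlt k₀.1 j.1 (by rw [k₀.2]; exact hμ2 j)
  have hA1 : ∀ j : ι₁, A ≤ D j.1 := fun j => by rw [hκ j]; exact Nat.le_add_right _ _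
  /- STEP 3: Taylor division of the least class -/
  set x : ι₁ → K[X] := fun i => X * ρ i.1 with hx
  set G : ι → K[X][X] := fun j => ∑ e : Fin N, C (c' j e) * (1 + X) ^ (e : ℕ) with hG
  have hGeval : ∀ (i : ι₁) (j : ι), (G j).eval (x i) = M' i.1 j := by
    intro i j
    rw [hG, hM', Matrix.of_apply]
    simp only [eval_finsetSum, eval_mul, eval_C, eval_pow, eval_add, eval_one, eval_X]
    refine Finset.sum_congr rfl fun e _ => ?_
    rw [hξ', hx]
    simp only [i.2, Nat.sub_self, pow_zero, one_mul, mul_comm]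
  set Ntop : Matrix ι₁ ι K[X] := Matrix.of fun k j =>
    (G j %ₘ ∏ i' : ι₁, (X - C (x i'))).coeff (κ k : ℕ) with hNtop
  set V : Matrix ι₁ ι₁ K[X] := Matrix.of fun i k => ρ i.1 ^ (κ k : ℕ) with hV
  set Dg : ι₁ → K[X] := fun k => X ^ (κ k : ℕ) with hDg
  have hkey : ∀ (i : ι₁) (j : ι), M' i.1 j = (V * (Matrix.diagonal Dg * Ntop)) i j := by
    intro i j
    rw [← hGeval i j, eval_node_eq_sum x (G j) i, ← Fin.sum_univ_eq_sum_range, Matrix.mul_apply,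
      ← Equiv.sum_comp κ]
    refine Finset.sum_congr rfl fun k _ => ?_
    rw [Matrix.diagonal_mul, hV, hNtop, hDg, hx, Matrix.of_apply, Matrix.of_apply, mul_pow]
    ring
  /- STEP 4: block decomposition along `ι ≃ ι₁ ⊕ ι₂` -/
  set σ : ι₁ ⊕ ι₂ ≃ ι := Equiv.sumCompl fun i => m i = m i₀ with hσ
  set N11 : Matrix ι₁ ι₁ K[X] := Matrix.of fun k j => Ntop k j.1 with hN11
  set N12 : Matrix ι₁ ι₂ K[X] := Matrix.of fun k j => Ntop k j.1 with hN12
  set M21 : Matrix ι₂ ι₁ K[X] := Matrix.of fun i j => M' i.1 j.1 with hM21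
  set M22 : Matrix ι₂ ι₂ K[X] := Matrix.of fun i j => M' i.1 j.1 with hM22
  have hblock : M'.submatrix σ σ =
      Matrix.fromBlocks (V * Matrix.diagonal Dg) 0 0 (1 : Matrix ι₂ ι₂ K[X]) *
        Matrix.fromBlocks N11 N12 M21 M22 := by
    rw [Matrix.fromBlocks_multiply]
    refine Matrix.ext ?_
    rintro (i | i) (j | j)
    · rw [Matrix.submatrix_apply, hσ, Equiv.sumCompl_apply_inl, Equiv.sumCompl_apply_inl,
        Matrix.fromBlocks_apply₁₁, Matrix.zero_mul, add_zero, Matrix.mul_assoc, hkey i j.1]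
      simp only [Matrix.mul_apply, hN11, Matrix.of_apply]
    · rw [Matrix.submatrix_apply, hσ, Equiv.sumCompl_apply_inl, Equiv.sumCompl_apply_inr,
        Matrix.fromBlocks_apply₁₂, Matrix.zero_mul, add_zero, Matrix.mul_assoc, hkey i j.1]
      simp only [Matrix.mul_apply, hN12, Matrix.of_apply]
    · rw [Matrix.submatrix_apply, hσ, Equiv.sumCompl_apply_inr, Equiv.sumCompl_apply_inl,
        Matrix.fromBlocks_apply₂₁, Matrix.zero_mul, zero_add, Matrix.one_mul, hM21, Matrix.of_apply]
    · rw [Matrix.submatrix_apply, hσ, Equiv.sumCompl_apply_inr, Equiv.sumCompl_apply_inr,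
        Matrix.fromBlocks_apply₂₂, Matrix.zero_mul, zero_add, Matrix.one_mul, hM22, Matrix.of_apply]
  have hVdet : V.det ≠ 0 := by
    set v : Fin (Fintype.card ι₁) → K[X] := fun a => ρ (κ.symm a).1 with hv
    have hVv : V = (Matrix.vandermonde v).submatrix κ κ := by
      refine Matrix.ext fun i k => ?_
      simp only [Matrix.submatrix_apply, Matrix.vandermonde_apply, hV, hv, Matrix.of_apply,
        Equiv.symm_apply_apply]
    rw [hVv, Matrix.det_submatrix_equiv_self, Matrix.det_vandermonde_ne_zero_iff]
    intro a b hab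
    have h1 : (κ.symm a).1 = (κ.symm b).1 :=
      hρ _ _ (by rw [(κ.symm a).2, (κ.symm b).2]) hab
    exact κ.symm.injective (Subtype.ext h1)
  have hDgdet : (Matrix.diagonal Dg).det ≠ 0 := by
    rw [Matrix.det_diagonal]
    exact Finset.prod_ne_zero_iff.mpr fun k _ => pow_ne_zero _ X_ne_zero
  rw [← Matrix.det_submatrix_equiv_self σ M', hblock, Matrix.det_mul, Matrix.det_fromBlocks_zero₂₁,
    Matrix.det_one, mul_one, Matrix.det_mul]
  refine mul_ne_zero (mul_ne_zero hVdet hDgdet) ?_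
  /- STEP 5: the leading block is congruent to the Pascal block modulo `X` -/
  set φ₀ : K[X] →+* K := Polynomial.evalRingHom 0 with hφ₀
  have hφx : ∀ i : ι₁, φ₀ (x i) = 0 := fun i => by
    rw [hφ₀, hx]
    simp
  have hGmap : ∀ j : ι, (G j).map φ₀ = C ((c j ⟨D j, hDN j⟩).coeff 0) * (1 + X) ^ (D j) := by
    intro j
    rw [hG, Polynomial.map_sum, Finset.sum_eq_single (⟨D j, hDN j⟩ : Fin N)]
    · rw [Polynomial.map_mul, map_C, Polynomial.map_pow, Polynomial.map_add, Polynomial.map_one,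
        map_X, hc'D, hφ₀, coe_evalRingHom, ← coeff_zero_eq_eval_zero]
    · intro e _ he
      have he' : (e : ℕ) ≠ D j := fun h => he (Fin.ext h)
      rw [Polynomial.map_mul, map_C, hφ₀, coe_evalRingHom, ← coeff_zero_eq_eval_zero, hc'0 j e he',
        C_0, zero_mul]
    · intro h
      exact absurd (Finset.mem_univ _) h
  have hN11map : N11.map φ₀ =
      (Matrix.of fun a b : Fin (Fintype.card ι₁) =>
          (((A + (b : ℕ)).choose (a : ℕ) : ℕ) : K)).submatrix κ κ *
        Matrix.diagonal fun j : ι₁ => (c j.1 ⟨D j.1, hDN j.1⟩).coeff 0 := by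
    refine Matrix.ext fun k j => ?_
    rw [Matrix.mul_diagonal, Matrix.map_apply, hN11, Matrix.of_apply, hNtop, Matrix.of_apply,
      map_coeff_modByMonic_nodes φ₀ x hφx (G j.1) (κ k).isLt, hGmap, coeff_C_mul,
      coeff_one_add_X_pow, Matrix.submatrix_apply, Matrix.of_apply, ← hκ j, mul_comm]
  have hd0 : φ₀ N11.det ≠ 0 := by
    rw [RingHom.map_det, RingHom.mapMatrix_apply, hN11map, Matrix.det_mul,
      Matrix.det_submatrix_equiv_self, pascal_det_eq_one, one_mul, Matrix.det_diagonal]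
    exact Finset.prod_ne_zero_iff.mpr fun j _ => hc0 j.1
  have hd : N11.det ≠ 0 := fun h => hd0 (by rw [h, map_zero])
  have hd0' : (N11.det).coeff 0 ≠ 0 := by
    rwa [hφ₀, coe_evalRingHom, ← coeff_zero_eq_eval_zero] at hd0
  /- STEP 6: Schur complement = same shape on `ι₂`, one class fewer -/
  refine det_fromBlocks_ne_zero_of_schur N11 N12 M21 M22 hd ?_
  set Ξ : Matrix ι₂ (Fin N) K[X] := Matrix.of fun i e => ξ' i.1 ^ (e : ℕ) with hΞ
  set Cm₁ : Matrix (Fin N) ι₁ K[X] := Matrix.of fun e j => c' j.1 e with hCm₁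
  set Cm₂ : Matrix (Fin N) ι₂ K[X] := Matrix.of fun e j => c' j.1 e with hCm₂
  set c₂ : ι₂ → Fin N → K[X] := fun j e => (N11.det • Cm₂ - Cm₁ * N11.adjugate * N12) e j with hc₂
  have hM21 : M21 = Ξ * Cm₁ := by
    refine Matrix.ext fun i j => ?_
    rw [hM21, Matrix.of_apply, hM', Matrix.of_apply, Matrix.mul_apply]
    rfl
  have hM22 : M22 = Ξ * Cm₂ := by
    refine Matrix.ext fun i j => ?_
    rw [hM22, Matrix.of_apply, hM', Matrix.of_apply, Matrix.mul_apply]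
    rfl
  have hS : N11.det • M22 - M21 * N11.adjugate * N12 =
      Matrix.of fun i j : ι₂ => ∑ e : Fin N,
        (X ^ (m i.1 - m i₀) * (1 + X * ρ i.1)) ^ (e : ℕ) * c₂ j e := by
    have h1 : N11.det • M22 - M21 * N11.adjugate * N12 =
        Ξ * (N11.det • Cm₂ - Cm₁ * N11.adjugate * N12) := by
      rw [hM21, hM22, Matrix.mul_sub, Matrix.mul_smul, Matrix.mul_assoc, Matrix.mul_assoc,
        Matrix.mul_assoc]
    rw [h1]
    refine Matrix.ext fun i j => ?_
    rw [Matrix.mul_apply, Matrix.of_apply]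
    rfl
  rw [hS]
  /- the induction hypothesis on `ι₂` -/
  have hlt₂ : Fintype.card ι₂ < n := by omega
  refine ih (Fintype.card ι₂) hlt₂ rfl (fun i : ι₂ => m i.1 - m i₀) (fun i => ρ i.1) (fun j => D j.1)
    A N c₂ (fun j => hDN j.1) ?_ ?_ ?_ ?_ ?_ ?_ ?_ ?_
  · -- valuations stay ≥ 1
    intro i
    have := hμ2 i
    omega
  · -- distinct within a class
    intro i i' h1 h2
    have := hμ2 i
    have := hμ2 i'
    exact Subtype.ext (hρ i.1 i'.1 (by omega) h2)
  · -- exponents injective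
    exact fun j j' h => Subtype.ext (hD h)
  · -- exponents below the new threshold `A`
    exact hA2
  · -- leading coefficient: constant term nonzero
    intro j
    have hvan : ∀ j' : ι₁, Cm₁ ⟨D j.1, hDN j.1⟩ j' = 0 := fun j' => by
      rw [hCm₁, Matrix.of_apply]
      refine hc'T j'.1 _ (hDT j.1) fun h => ?_
      have hjj : j.1 = j'.1 := hD (by simpa using h)
      exact j.2 (by rw [hjj]; exact j'.2)
    have hrow : (Cm₁ * N11.adjugate * N12) ⟨D j.1, hDN j.1⟩ j = 0 := by
      rw [Matrix.mul_assoc, Matrix.mul_apply]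
      exact Finset.sum_eq_zero fun j' _ => by rw [hvan j', zero_mul]
    rw [hc₂]
    simp only [Matrix.sub_apply, Matrix.smul_apply, smul_eq_mul, hrow, sub_zero, hCm₂, Matrix.of_apply,
      hc'D, mul_coeff_zero]
    exact mul_ne_zero hd0' (hc0 j.1)
  · -- no other term below `A`
    intro j e h1 h2
    have hv2 : Cm₂ e j = 0 := by
      rw [hCm₂, Matrix.of_apply]
      exact hc'T j.1 e (h1.trans hAT) h2
    have hv1 : ∀ j' : ι₁, Cm₁ e j' = 0 := fun j' => by
      rw [hCm₁, Matrix.of_apply]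
      exact hc'T j'.1 e (h1.trans hAT) (fun h => absurd (hA1 j') (by omega))
    have hrow : (Cm₁ * N11.adjugate * N12) e j = 0 := by
      rw [Matrix.mul_assoc, Matrix.mul_apply]
      exact Finset.sum_eq_zero fun j' _ => by rw [hv1 j', zero_mul]
    rw [hc₂]
    simp only [Matrix.sub_apply, Matrix.smul_apply, smul_eq_mul, hrow, sub_zero, hv2, mul_zero]
  · -- across classes
    intro i i' h
    have := hμ2 i
    have := hμ2 i'
    exact hlt i.1 i'.1 (by omega)
  · -- within a class
    intro i i' h
    have h3 := hμ2 i
    have h4 := hμ2 i'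
    have h5 : m i.1 = m i'.1 := by omega
    have h6 := heq i.1 i'.1 h5
    have h7 : Fintype.card {k : ι₂ // m k.1 - m i₀ = m i.1 - m i₀} = Fintype.card {k // m k = m i.1} := by
      rw [Fintype.card_congr (Equiv.subtypeSubtypeEquivSubtype (p := fun k => ¬ m k = m i₀)
        (q := fun k => m k - m i₀ = m i.1 - m i₀) (fun k hk => by omega))]
      exact Fintype.card_congr (Equiv.subtypeEquivRight fun k => by constructor <;> intro hk <;> omega)
    rw [h7]
    exact h6

/-- **BLOCK GENERALIZED VANDERMONDE.** For rows `ξ_i = X^{m_i}(1 + X ρ_i) ∈ K[X]` (`m_i ≥ 1`, the `ρ_i`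
distinct within each valuation class `{m = const}`) and columns `F_j(z) = Σ_{e<N} c_{j e} z^e` whose only term
below degree `T` is `c_{j,D_j} z^{D_j}` with `c_{j,D_j}(0) ≠ 0` (`D_j < T`), if the exponents `D_j` are distinct,
decrease from each valuation class to every higher one, and within a class of size `g` differ pairwise by `< g`,
then `det [F_j(ξ_i)]_{i,j} ≠ 0`. (Columns are indexed by the row type: the matching class ↔ run is the identity.) -/
theorem det_blockVandermonde_ne_zero (K : Type*) [Field K] {ι : Type u} [Fintype ι] [DecidableEq ι]
    (m : ι → ℕ) (ρ : ι → K[X]) (D : ι → ℕ) (T N : ℕ) (c : ι → Fin N → K[X]) (hDN : ∀ j, D j < N)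
    (hm : ∀ i, 1 ≤ m i) (hρ : ∀ i i', m i = m i' → ρ i = ρ i' → i = i') (hD : Function.Injective D)
    (hDT : ∀ j, D j < T) (hc0 : ∀ j, (c j ⟨D j, hDN j⟩).coeff 0 ≠ 0)
    (hcT : ∀ j (e : Fin N), (e : ℕ) < T → (e : ℕ) ≠ D j → c j e = 0)
    (hlt : ∀ i i', m i < m i' → D i' < D i)
    (heq : ∀ i i', m i = m i' → D i < D i' + Fintype.card {k // m k = m i}) :
    (Matrix.of fun i j : ι => ∑ e : Fin N, (X ^ (m i) * (1 + X * ρ i)) ^ (e : ℕ) * c j e).det ≠ 0 :=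
  det_ne_zero_aux K (Fintype.card ι) rfl m ρ D T N c hDN hm hρ hD hDT hc0 hcT hlt heq

/-- **BLOCK VANDERMONDE, pure powers.** `det [ξ_i^{D_j}]_{i,j} ≠ 0` in `K[X]` for `ξ_i = X^{m_i}(1 + X ρ_i)`
(`m_i ≥ 1`, `ρ` distinct within valuation classes) whenever the distinct exponents `D_j` decrease across increasing
valuation classes and lie within a window of width `<` the class size inside each class (so each class of size `g`
carries `g` CONSECUTIVE exponents). In any characteristic — this is the leading-term count
`#SSYT = 1` for block-constant shapes, proved here without Schur polynomials. -/
theorem det_pow_ne_zero_of_blocks (K : Type*) [Field K] {ι : Type u} [Fintype ι] [DecidableEq ι]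
    (m : ι → ℕ) (ρ : ι → K[X]) (D : ι → ℕ)
    (hm : ∀ i, 1 ≤ m i) (hρ : ∀ i i', m i = m i' → ρ i = ρ i' → i = i') (hD : Function.Injective D)
    (hlt : ∀ i i', m i < m i' → D i' < D i)
    (heq : ∀ i i', m i = m i' → D i < D i' + Fintype.card {k // m k = m i}) :
    (Matrix.of fun i j : ι => (X ^ (m i) * (1 + X * ρ i)) ^ (D j)).det ≠ 0 := by
  obtain ⟨N, hN⟩ : ∃ N, ∀ j, D j < N :=
    ⟨Finset.univ.sup D + 1, fun j => Nat.lt_succ_of_le (Finset.le_sup (Finset.mem_univ j))⟩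
  have key := det_blockVandermonde_ne_zero K m ρ D N N
    (fun j e => if (e : ℕ) = D j then (1 : K[X]) else 0) hN hm hρ hD hN
    (fun j => by simp) (fun j e _ h2 => by simp [h2]) hlt heq
  have hmat : (Matrix.of fun i j : ι => (X ^ (m i) * (1 + X * ρ i)) ^ (D j)) =
      Matrix.of fun i j : ι => ∑ e : Fin N, (X ^ (m i) * (1 + X * ρ i)) ^ (e : ℕ) *
        (if (e : ℕ) = D j then (1 : K[X]) else 0) := by
    refine Matrix.ext fun i j => ?_
    rw [Matrix.of_apply, Matrix.of_apply, Finset.sum_eq_single (⟨D j, hN j⟩ : Fin N)]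
    · simp
    · intro e _ he
      rw [if_neg fun h => he (Fin.ext h), mul_zero]
    · intro h
      exact absurd (Finset.mem_univ _) h
  rw [hmat]
  exact key

/-- **Peeling a zero row.** If `ξ_{i₀} = 0` and column `i₀` is the only one with exponent `0`, then row `i₀`
of `[ξ_i^{D_j}]` is the indicator of column `i₀` (`0^0 = 1`), so the matrix is nonsingular as soon as its minor
off `(i₀, i₀)` is. (Used for the empty row, whose code polynomial vanishes.) -/
theorem det_pow_ne_zero_of_zero_row {R : Type*} [CommRing R] {ι : Type u} [Fintype ι] [DecidableEq ι]
    (ξ : ι → R) (D : ι → ℕ) (i₀ : ι) (hξ : ξ i₀ = 0) (hD0 : D i₀ = 0) (hD : ∀ j, j ≠ i₀ → D j ≠ 0)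
    (hminor : (Matrix.of fun i j : {i // i ≠ i₀} => ξ i.1 ^ D j.1).det ≠ 0) :
    (Matrix.of fun i j : ι => ξ i ^ D j).det ≠ 0 := by
  set M : Matrix ι ι R := Matrix.of fun i j : ι => ξ i ^ D j with hM
  set σ : {i // i ≠ i₀} ⊕ {i // ¬ i ≠ i₀} ≃ ι := Equiv.sumCompl fun i => i ≠ i₀ with hσ
  haveI : Unique {i // ¬ i ≠ i₀} :=
    ⟨⟨⟨i₀, fun h => h rfl⟩⟩, fun i => Subtype.ext (not_not.mp i.2)⟩
  have hval : ∀ i : {i // ¬ i ≠ i₀}, i.1 = i₀ := fun i => not_not.mp i.2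
  have hblock : M.submatrix σ σ =
      Matrix.fromBlocks (Matrix.of fun i j : {i // i ≠ i₀} => ξ i.1 ^ D j.1)
        (Matrix.of fun (i : {i // i ≠ i₀}) (_ : {i // ¬ i ≠ i₀}) => ξ i.1 ^ D i₀)
        0 (Matrix.of fun _ _ : {i // ¬ i ≠ i₀} => (1 : R)) := by
    refine Matrix.ext ?_
    rintro (i | i) (j | j)
    · rw [Matrix.submatrix_apply, hσ, Equiv.sumCompl_apply_inl, Equiv.sumCompl_apply_inl,
        Matrix.fromBlocks_apply₁₁, hM, Matrix.of_apply, Matrix.of_apply]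
    · rw [Matrix.submatrix_apply, hσ, Equiv.sumCompl_apply_inl, Equiv.sumCompl_apply_inr,
        Matrix.fromBlocks_apply₁₂, hM, Matrix.of_apply, Matrix.of_apply, hval j]
    · rw [Matrix.submatrix_apply, hσ, Equiv.sumCompl_apply_inr, Equiv.sumCompl_apply_inl,
        Matrix.fromBlocks_apply₂₁, hM, Matrix.of_apply, Matrix.zero_apply, hval i, hξ,
        zero_pow (hD j.1 j.2)]
    · rw [Matrix.submatrix_apply, hσ, Equiv.sumCompl_apply_inr, Equiv.sumCompl_apply_inr,
        Matrix.fromBlocks_apply₂₂, hM, Matrix.of_apply, Matrix.of_apply, hval j, hD0, pow_zero]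
  rw [← Matrix.det_submatrix_equiv_self σ M, hblock, Matrix.det_fromBlocks_zero₂₁,
    Matrix.det_unique (Matrix.of fun _ _ : {i // ¬ i ≠ i₀} => (1 : R)), Matrix.of_apply, mul_one]
  exact hminor

end

end Summit.ValiantsHypothesis.ValiantsHypothesis.Theorems.BarrierLever.BlockVandermonde
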